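import Summits.AtomisticToContinuum.Crystallization.Theorems.ChartedZeroExcessLayeredLatticeLiouvilleR

/-!
# Zero-excess layered lattice Liouville — part S (lens-2 g31, node «IndexDecayReChart»): the split-decay leaf (D) DECOMPOSED

Target (critic row 525 (iii), VERBATIM decl of part R): `SplitDecayPL aHi Λ θ s s'` — «a `ϱ`-truncated-harmonic split at `(ρ; κh, κd)` under an
equilibrium `s`-chart ⇒ registered-flat at `(t·ρ, C·(t²·κh + κd/t³))` under an equilibrium `s'`-chart, uniformly in the range `ϱ ≥ ϱ₁`».
Column instance `(aHi; Λ, θ, s, s') = (1; 2, 1/16, 1/50, 1/25)`.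

## THE CUT (ruled shape «D ⟸ D₁ InteriorDecayCert ∧ D₂ ReChart, glue PROVED», with ONE typing-forced bookkeeping piece D₀)

  (D) `SplitDecayPL aHi Λ θ s s'`  ⟸  (D₀) `TameReindex s Λ`  ∧  (D₁) `InteriorDecayCert`  ∧  (D₂) `ReChartPL aHi Λ θ s s'`
  — `splitDecayPL_of_reindex_decay_rechart`, PROVED (0 sorry; pure threading of constants, ranges, ratios and floors).

| piece | currency | type | status / tag | size |
|---|---|---|---|---|
| (D₀) `TameReindex` | (U)'s certificate ⇒ the same certificate for a TAME (height-ordered, bounded-step) indexing | LINEAR bookkeeping | WEAKER · TRUE-type · ATTACKABLE | S–M |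
| (D₁) `InteriorDecayCert` | index fields on certified layered crystals, `IsTruncHarmonicZ`, `IsAffine`, `idxEnergy` on `idxBall` | LINEAR, configuration-free AND chart-free | UNDECIDED · TRUE-type · INSTRUMENTABLE (census TRUNC-DECAY, normalisation below) · ATTACKABLE | M–L |
| (D₂) `ReChartPL` | split data + the (D₁)-package for the chart's tame indexing ⇒ `NearHomH1BDE` at `t·ρ` | RE-CHART bookkeeping (Taylor part ↦ new equilibrium chart) | UNDECIDED · TRUE-type · ATTACKABLE | M |

D-g30-1 AS RULED (critic row 525), clause by clause: (1) the fields of (D₁) are `φ : Cell 2 → ℤ → E3` on a `(c₀, κ₀)`-certified layered crystal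
(`IsLayeredCrystal c₀`, `CoerciveZ … κ₀`) — and (D₁) is even chart-free: its constants depend on `(κ₀, c₀, C₁)` only (`C₁` = tameness of the
indexing, which for an equilibrium chart is a function of `Λ` and cleanliness), uniform in `ϱ ≥ ϱ₁`; (2) truncation by PHYSICAL bond length,
`if ϱ < ‖lsite y − lsite x‖ then 0 else K …` — literally the complement of (T)'s tail summand, one cut convention for (T) and (D₁); (3) Taylor class :=
`IsAffine` (part A root decl: one in-plane gradient, free per-layer constants) = the Liouville class of part B (`LinLiouville K := … → IsAffine u`),
so (D₁) and `LayeredLiouvilleCert` speak the same class; (4) remainder := `idxEnergy (φ − T)` (the `nnFormZ` summand restricted to pairs inside the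
index ball) on `idxBall x₀ (t·n)`, normalised by site count (`Set.ncard`, cross-multiplied — no division), law `t²` typed.

## TYPING-FORCED FINDING (why D₀ exists): (U)'s certificate is co-Lipschitz only
`IsLayeredCrystal c₀` bounds INDEX distance by PHYSICAL distance (`c₀·dist ≤ ‖lsite − lsite‖`), not conversely: a witness `w'` of (U) may enumerate
the layers non-monotonically in height (index-adjacent layers physically far apart), and nothing in (U) forbids it.  Interior decay on index balls and
the physical-ball ↔ index-ball dictionary of (D₂) both need the converse bound — TAMENESS `IsTameIndexing C₁ a b w'`: `‖a‖, ‖b‖ ≤ C₁` and layer steps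
`‖w'(m+1) − w' m‖ ≤ C₁` (then `lsite` is `3C₁`-Lipschitz for the sup metric).  (D₀) `TameReindex := (U) → (U♮)` is the transfer: re-enumerate the
layers of the clean chart by height (co-Lipschitz and tame with constants from cleanliness and `Λ`) and transport `CoerciveZ` by TELESCOPING — a
height-adjacent pair of layers is `≤ k(c₀)` index steps apart in ANY co-Lipschitz enumeration, so `nnFormZ_{tame} ≤ k(c₀)²·(multiplicity)·nnFormZ_{w'}`
and `κ₀ ↦ κ₀ / (k² · mult)`; the second variation is enumeration-independent.  TRUE-type, S–M.  (`uniformEquilStability_of_tame : (U♮) → (U)` is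
proved here, so a column may equally take (U♮) = census TAG 174 (a⁗) with the natural indexing as its single stability leaf:
`splitDecayPL_of_tame_decay_rechart`.)

## GLUE CONSTANTS (proof of `splitDecayPL_of_reindex_decay_rechart`)
Given `δ, a`: (D₀)∘(U) at `a` gives `(κ₀, c₀, C₁)` and, per equilibrium chart, a tame certified indexing `w'`; (D₁) at `(κ₀, c₀, C₁)` gives the decay
constant `C_D ≥ 1` and the range floor `ϱ₁`; (D₂) at `(δ, a, κ₀, c₀, C₁, C_D)` gives the ratio distortion `K ≥ 1` (index radius of the small ball /
index radius of the big ball `= K·t`, `K ≈ 3C₁/c₀`) and the output constant `C'`.  (D) then holds with `C := C'`, `ϱ₁ := ϱ₁`: for `ϱ ≥ ϱ₁` and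
`t ∈ (0, 1/2]` put `t' := min (1/2) (K t)`; (D₁) at `(ϱ, t')` gives the index floor `n₁`; (D₂) at `(ϱ, t, n₁)` gives `(η₁, R₁)`; a split
`NearHarmSplitE` is unpacked into its chart `(L, w)` and data `(Ψ, h, σ, τ)`, (D₀) supplies `w'`, (D₁) the package `DecayAt C_D ϱ t' n₁ (L t₁) (L t₂) w'`,
and (D₂) returns `NearHomH1BDE a s' Λ (C'·(t² κh + κd/t³)) 4 (t ρ) S (win (t ρ))`.  When `K t > 1/2` no decay is needed (restriction alone gives level
`≲ (κh + κd)/t³ ≤ 32 K⁵·t²·κh + κd/t³`), which is why (D₂) may ask for the package at the clipped ratio `t'`.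

## WHY EACH PIECE IS STRICTLY SMALLER THAN (D), AND NONE IS (D) IN COSTUME
(D₀) never sees a configuration `S`, a split or a registration: it is a statement about enumerations of clean layered sets.  (D₁) never sees `S`, a
chart class, `Ψ`, `EnvClose` or `NearHomH1BDE`: it is linear interior regularity for coercive finite-range LAMINATE systems on `ℤ² × ℤ` (coefficients
constant along cells, arbitrary along the layer index), the statement a numerical census can test.  (D₂) assumes the decay it needs as a typed
hypothesis (`DecayAt …`) and contributes only the re-chart: absorb the `IsAffine` Taylor part `γ ↦ Σ γⱼ aⱼ + c_k` into a new equilibrium chart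
`((I + B) L, re-equilibrated offsets)` — the per-layer constants `c_k` are re-equilibrated at cost `≲ t² κh` because `h` is truncated-harmonic (the
layer-mean profile of a harmonic field is affine across layers up to `nn`-differences of size `t·√κh`; interlayer stiffness = `κ₀` on layer-constant
modes), `s' > s` absorbs `‖B‖ ≲ √κh ≤ √η₁`, translation freedom + discrete Poincaré regenerate the position clause, `EnvClose` is re-derived from the
cleanliness of `S` and of the chart plus registration consistency, and the `κd/t³` term is the defect level re-normalised to the smaller window.
Probes (`g31/bc/probes_g31S.lean`): each piece ⇏ (D), (D) ⇏ each piece, no piece provable/refutable outright, pieces ⇏ N (MUST-FAIL, reproduced).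

## WHY THIS IS NOVEL (lens «structural dichotomy», problem-relative)
The regularity leaf of an atomistic ε-regularity scheme is cut so that its ANALYTIC content is a chart-free statement about discrete laminates —
interior `C^{1,1}`-type decay in the tangential variables with FREE per-layer constants (the discrete analogue of Chipot–Kinderlehrer–Vergara-Caffarelli
smoothness of linear laminates, here for a finite-range multilattice force-constant operator with an APERIODIC layer sequence) — while everything
configuration-dependent is confined to a re-chart lemma whose only analytic input is a typed decay package.  Searches (corpus fts+vec, galaxy): no
discrete/atomistic laminate interior estimate with aperiodic stacking found; nearest: Olson–Ortner (multilattice point-defect decay, periodic),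
Ehrlacher–Ortner–Shapeev 2016 (Bravais lattice Green's function decay), CKVC 1986 (continuum laminates) — see memo §6 for labelled hits.

## CENSUS SHAPE OF (D₁) (unblocks TAG TRUNC-DECAY, deferred by critic row 525 (iv) «until D₁ typed»)
Instance: `(a, b, w)` = fcc / hcp / dhcp / 9R equilibrium charts at `a⋆` with the natural (height-ordered) indexing; `ϱ ∈ {5/2, 3, 4}`,
`t ∈ {1/4, 1/2}`, `n ∈ {8, 12, 16}`; random Dirichlet data on the collar `idxBall x₀ (n + ϱ/c₀) \ idxBall x₀ n`, solve `IsTruncHarmonicZ ϱ` on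
`idxBall x₀ n`, fit the best `IsAffine T` on `idxBall x₀ (t n)` (least squares in `idxEnergy`), report
`Ĉ_D := sup_φ [idxEnergy (φ − T) (idxBall x₀ (t n)) · #idxBall x₀ n] / [t² · idxEnergy φ (idxBall x₀ n) · #idxBall x₀ (t n)]` — (D₁) predicts `Ĉ_D`
bounded uniformly in `(n, ϱ, structure)`; growth like `t⁻³` would mean «no tangential sup bound» and force the re-typing `t^{1+α}`.

## LEAVES OF THE COLUMN `_16XH5` (this node): (T) ATTACKABLE·M · (U) INSTRUMENTABLE (TAG 174 (a⁗)) · (A) RESIDUAL-DESIGNATE (core A1, g32) ·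
(D₀) ATTACKABLE·S–M · (D₁) INSTRUMENTABLE (TRUNC-DECAY) + ATTACKABLE·M–L · (D₂) ATTACKABLE·M · (P), (C), R_G, X, Z_E, L, L′, HBG″ as of record.
No new BARRIER leaf; `LocalizedPotentialsExcludeLennardJones` stays discharged BY TYPE via (T) (one cut convention, clause (2)).  IDEA-NEEDED: none at (D).
The A-side pre-analysis for g32 (H¹ split vs L² harmonic approximation: which wildness residual is forced) is in the memo `NODE-g31-IndexDecayReChart.md` §A.
-/

noncomputable section

open scoped BigOperators InnerProductSpace RealInnerProductSpace
open MeasureTheory Set Metric Filter Topology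
open Summit.AtomisticToContinuum.Crystallization.Theorems.ChartedPlanarOrderRigidityDoor
  (E3 IsClean IsNash IsCharted IsEStarGSC VisibleGap PertRegime atomsIn siteEnergy eStar BindingSurface)
open Summit.AtomisticToContinuum.Crystallization.Theorems.ChartedPlanarOrderDensityDichotomy (μS IsSep nK nK_nonneg excess)
open Summit.AtomisticToContinuum.Crystallization.Theorems.ChartedPlanarOrderMesoCut (IsDoorSet NearHom LayeredHom EnvClose)
open Summit.AtomisticToContinuum.Crystallization.Theorems.OverbindingBudgetLiouvilleDictionary (NearHomBD)
open Summit.AtomisticToContinuum.Crystallization.Theorems.ChartedPlanarOrderDoorLayered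
  (TwoPeriodic DoorPeriodic PeriodicBulkGapDoor gap_and_pert_1_50_of_periodic NearHomL2BD nearHomL2BD_mono nearHomBD_of_nearHomL2BD
   sq_le_finsum_mem not_nearHomL2BD_singleton envClose_mono Layered layeredHom_eq_layered atomsIn_subset)
open Summit.AtomisticToContinuum.Crystallization.Theorems.ChartedPlanarOrderDoorLayeredOsc (IsTwoShellAffineGood DoorPeriodicOsc)
open Summit.AtomisticToContinuum.Crystallization.Theorems.ChartedPlanarOrderCleanScaleP
  (IsCleanP IsDoorSetP DoorPeriodicP isDoorSetP_mono doorPeriodic_of_doorPeriodicP isDoorSetP_one_iff doorPeriodicP_one_iff)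
open Literature.MathematicalPhysics.StatisticalMechanics (haggLabel barlowOffset layerNormal IsHaggSeq triangularVec₁ triangularVec₂)

namespace Summit.AtomisticToContinuum.Crystallization.Theorems.ChartedZeroExcessLayeredLatticeLiouville

/-! ## §IV.1  Index currency for (D₁) (definition request D-g30-1, ruled clauses (1)–(4)) -/

/-- the INDEX BALL of radius `n` about `x₀` in `ℤ² × ℤ` (sup metric; a finite set, `(2⌊n⌋+1)³` sites). [this file, g31] -/
def idxBall (x₀ : Cell 2 × ℤ) (n : ℝ) : Set (Cell 2 × ℤ) :=
  {y | dist y x₀ ≤ n}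

/-- the LOCALISED index nearest-neighbour energy: the `nnFormZ` summand `‖φ q − φ p‖²` summed over ordered pairs `(p, q)` of sites of `B` at index
sup-distance `≤ 1` (a `finsum` over a set — finite when `B` is; clause (4) of D-g30-1). [this file, g31] -/
def idxEnergy (φ : Cell 2 → ℤ → E3) (B : Set (Cell 2 × ℤ)) : ℝ :=
  ∑ᶠ x ∈ {x : (Cell 2 × ℤ) × (Cell 2 × ℤ) | x.1 ∈ B ∧ x.2 ∈ B ∧ dist x.1 x.2 ≤ 1}, ‖φ x.2.1 x.2.2 - φ x.1.1 x.1.2‖ ^ 2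

/-- **`ϱ`-TRUNCATED HARMONICITY IN INDEX FORM** on `P ⊆ ℤ² × ℤ` for the layered crystal `(a, b, w)`: at every `x ∈ P` the truncated linearised force
`Σ_{y : ‖lsite y − lsite x‖ ≤ ϱ} K(y − x)(φ y − φ x)` vanishes — truncation by PHYSICAL bond length with the cut `ϱ < ‖lsite y − lsite x‖ ↦ 0`, literally the
complement of (T)'s tail summand (clause (2)); a `HasSum` over all of `ℤ² × ℤ` of a finitely supported family (co-Lipschitz ⇒ finitely many sites within
`ϱ`), so no junk.  For `H = Layered a b w` and `φ = h ∘ lsite` this is `IsTruncHarmonic ϱ H h (lsite '' P)` of part R. [this file, g31] -/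
def IsTruncHarmonicZ (ϱ : ℝ) (a b : E3) (w : ℤ → E3) (φ : Cell 2 → ℤ → E3) (P : Set (Cell 2 × ℤ)) : Prop :=
  ∀ x ∈ P, HasSum (fun y : Cell 2 × ℤ =>
    if ϱ < ‖lsite a b w y.1 y.2 - lsite a b w x.1 x.2‖ then (0 : E3)
    else layeredKernel a b w (y.1 - x.1) x.2 y.2 (φ y.1 y.2 - φ x.1 x.2)) 0

/-- **TAME indexing** `IsTameIndexing C₁ a b w`: in-plane generators and consecutive layer offsets are bounded by `C₁` — the converse of co-Lipschitz
(`lsite` is then `3C₁`-Lipschitz for the sup metric of `ℤ² × ℤ`); automatic for the natural height-ordered indexing of a clean chart, NOT implied by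
`IsLayeredCrystal` (see the header's typing-forced finding).  Non-vacuous: `isTameIndexing_cubic`. [this file, g31] -/
def IsTameIndexing (C₁ : ℝ) (a b : E3) (w : ℤ → E3) : Prop :=
  ‖a‖ ≤ C₁ ∧ ‖b‖ ≤ C₁ ∧ ∀ m : ℤ, ‖w (m + 1) - w m‖ ≤ C₁

/-- **THE DECAY PACKAGE** `DecayAt C ϱ t n₁ a b w` (what (D₁) delivers and (D₂) consumes): every field `φ` that is `ϱ`-truncated-harmonic on an index
ball `idxBall x₀ n`, `n ≥ n₁`, has an `IsAffine` Taylor part `T` (one in-plane gradient, free per-layer constants — clause (3)) with the COUNT-NORMALISED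
`t²` law `idxEnergy (φ − T) (idxBall x₀ (t n)) / #idxBall x₀ (t n) ≤ C · t² · idxEnergy φ (idxBall x₀ n) / #idxBall x₀ n` (cross-multiplied; clause (4)).
[this file, g31] -/
def DecayAt (C ϱ t n₁ : ℝ) (a b : E3) (w : ℤ → E3) : Prop :=
  ∀ (φ : Cell 2 → ℤ → E3) (x₀ : Cell 2 × ℤ) (n : ℝ), n₁ ≤ n →
    IsTruncHarmonicZ ϱ a b w φ (idxBall x₀ n) →
      ∃ T : Cell 2 → ℤ → E3, IsAffine T ∧
        idxEnergy (φ - T) (idxBall x₀ (t * n)) * ((idxBall x₀ n).ncard : ℝ) ≤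
          C * t ^ 2 * idxEnergy φ (idxBall x₀ n) * ((idxBall x₀ (t * n)).ncard : ℝ)

/-- a constant field is truncated-harmonic everywhere (sanity; every summand vanishes). [this file, g31] -/
theorem isTruncHarmonicZ_const (ϱ : ℝ) (a b : E3) (w : ℤ → E3) (P : Set (Cell 2 × ℤ)) (v : E3) :
    IsTruncHarmonicZ ϱ a b w (fun _ _ => v) P := by
  intro x _
  have h0 : (fun y : Cell 2 × ℤ => if ϱ < ‖lsite a b w y.1 y.2 - lsite a b w x.1 x.2‖ then (0 : E3)
      else layeredKernel a b w (y.1 - x.1) x.2 y.2 (v - v)) = fun _ => 0 := by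
    funext y
    simp
  rw [h0]
  exact hasSum_zero

/-- the localised index energy is nonnegative. [this file, g31] -/
theorem idxEnergy_nonneg (φ : Cell 2 → ℤ → E3) (B : Set (Cell 2 × ℤ)) : 0 ≤ idxEnergy φ B :=
  finsum_nonneg fun _ => finsum_nonneg fun _ => by positivity

/-- a constant field has zero localised index energy. [this file, g31] -/
theorem idxEnergy_const (v : E3) (B : Set (Cell 2 × ℤ)) : idxEnergy (fun _ _ => v) B = 0 := by
  simp [idxEnergy]

/-- NON-VACUITY of tameness: the simple-cubic indexing `(e₀, e₁, m ↦ m • e₂)` is `1`-tame (and `1`-co-Lipschitz: `isLayeredCrystal_cubic`). [this file, g31] -/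
theorem isTameIndexing_cubic :
    IsTameIndexing 1 (EuclideanSpace.single 0 1) (EuclideanSpace.single 1 1)
      (fun m : ℤ => (m : ℝ) • EuclideanSpace.single (2 : Fin 3) (1 : ℝ)) := by
  refine ⟨?_, ?_, fun m => ?_⟩
  · simp
  · simp
  · have h1 : ((m + 1 : ℤ) : ℝ) • EuclideanSpace.single (2 : Fin 3) (1 : ℝ) - (m : ℝ) • EuclideanSpace.single (2 : Fin 3) (1 : ℝ) =
        EuclideanSpace.single (2 : Fin 3) (1 : ℝ) := by
      rw [← sub_smul]
      push_cast
      simp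
    rw [h1]
    simp

/-! ## §IV.2  The three pieces beneath (D): (D₀) tame re-indexing, (D₁) interior decay, (D₂) re-chart -/

/-- ★ **(U♮) «UniformTameStability s Λ»** — (U) WITH A TAME INDEXING: uniform `(κ₀, c₀, C₁)` such that every equilibrium `s`-chart's layered set admits
a re-indexing `w'` (same set, in-plane generators the chart's own `L t₁, L t₂`) that is `c₀`-co-Lipschitz, `C₁`-tame AND `κ₀`-coercive.  This is what
census TAG 174 (a⁗) certifies LITERALLY (the census indexes layers by height).  INSTRUMENTABLE; implies (U) (`uniformEquilStability_of_tame`). [this file, g31] -/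
def UniformTameStability (s Λ : ℝ) : Prop :=
  ∀ a : ℝ, 0 < a → ∃ κ₀ : ℝ, 0 < κ₀ ∧ ∃ c₀ : ℝ, 0 < c₀ ∧ ∃ C₁ : ℝ, 0 < C₁ ∧
    ∀ (L : E3 ≃L[ℝ] E3) (w : ℤ → E3), IsEquilChart a s Λ L w →
      ∃ w' : ℤ → E3,
        Layered ((L : E3 →L[ℝ] E3) (triangularVec₁ 1)) ((L : E3 →L[ℝ] E3) (triangularVec₂ 1)) w' = LayeredHom (L : E3 →L[ℝ] E3) w ∧
        IsLayeredCrystal c₀ ((L : E3 →L[ℝ] E3) (triangularVec₁ 1)) ((L : E3 →L[ℝ] E3) (triangularVec₂ 1)) w' ∧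
        IsTameIndexing C₁ ((L : E3 →L[ℝ] E3) (triangularVec₁ 1)) ((L : E3 →L[ℝ] E3) (triangularVec₂ 1)) w' ∧
        CoerciveZ (layeredKernel ((L : E3 →L[ℝ] E3) (triangularVec₁ 1)) ((L : E3 →L[ℝ] E3) (triangularVec₂ 1)) w') κ₀

/-- ★ **(D₀) «TameReindex s Λ» := (U) → (U♮)** — THE TAME RE-INDEXING TRANSFER (typing-forced, see header): from (U)'s certificate with an arbitrary
co-Lipschitz enumeration of the layers, produce the height-ordered enumeration (co-Lipschitz and tame with constants from cleanliness of the chart and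
`Λ`) and transport coercivity by telescoping index-adjacent differences (`κ₀ ↦ κ₀/(k(c₀)²·mult)`; the second variation is enumeration-independent).
WEAKER · TRUE-type · ATTACKABLE·S–M.
Why it might fail: only if a clean equilibrium chart could have two layers in one height band or unbounded consecutive height gaps — both excluded by
two-shell cleanliness (layer gaps `∈ [0.7a, 1.1a]`); the telescoping loses a `c₀`-dependent factor, nothing else.
Sources: [this tree: `IsLayeredCrystal`, `isSep_of_isLayeredCrystal`, `injective_lsite_of_isLayeredCrystal`, `CoerciveZ`], [EMing2006 §2 (multilattice
indexing)], [census TAG 174 (a⁗), A174.md]. [this file, g31] -/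
def TameReindex (s Λ : ℝ) : Prop :=
  UniformEquilStability s Λ → UniformTameStability s Λ

/-- ★★ **(D₁) «InteriorDecayCert»** — INTERIOR DECAY FOR TRUNCATED-HARMONIC INDEX FIELDS (configuration-free AND chart-free, LINEAR): given the tail
certificate (T), for every ellipticity `κ₀`, co-Lipschitz constant `c₀` and tameness `C₁` there are a decay constant `C_D ≥ 1` and a range floor `ϱ₁`
such that, UNIFORMLY in the range `ϱ ≥ ϱ₁` and for every ratio `t ∈ (0, 1/2]` (index floor `n₁` after `(ϱ, t)`), every `c₀`-co-Lipschitz `C₁`-tame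
`κ₀`-coercive layered crystal delivers the package `DecayAt C_D ϱ t n₁`: truncated-harmonic on `idxBall x₀ n` ⇒ `IsAffine` Taylor part with the
count-normalised `t²` law.  Mechanism: the operator is a coercive (by `CoerciveZ` minus the (T)-tail, for `ϱ ≥ ϱ₁(κ₀, c₀)`) finite-range LAMINATE system on
`ℤ² × ℤ` — translation-invariant along cells, arbitrary along the layer index; cell-differences of solutions are solutions, so tangential first, second and
mixed differences obey Caccioppoli + tangential Sobolev sup bounds, and the FREE per-layer constants of `IsAffine` absorb all normal variation (no
regularity across layers is claimed or needed); kernel rows decay like `(c₀·dist)⁻⁸` (`norm_forceConst_le` + co-Lipschitz).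
UNDECIDED · TRUE-type · INSTRUMENTABLE (census TRUNC-DECAY, header §census) · ATTACKABLE·M–L.
Why it might fail: the `t²` law needs SUP bounds on tangential second differences of a laminate system with an aperiodic layer sequence (discrete
Chipot–Kinderlehrer–Vergara-Caffarelli); with `L²`-Caccioppoli alone the count-normalised law degrades by `t⁻³` — then re-type `t^{1+α}` (ruled admissible).
Sources: [giaquinta1984 pp 94–122, Ch. III (Campanato, interior estimates for systems with constant coefficients)], [CKVC1986 Chipot–Kinderlehrer–
Vergara-Caffarelli, Smoothness of linear laminates, ARMA 96], [EOS2016 Ehrlacher–Ortner–Shapeev arXiv:1306.5334 (lattice Green's function / discrete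
regularity)], [OlsonOrtner2017 arXiv:1608.08930 (multilattice decay)], [this tree: part B `linLiouville_of_boundedFlat_of_gammaKernelBdd`, `CoerciveZ`,
part R `TailDominationCert`]. [this file, g31] -/
def InteriorDecayCert : Prop :=
  TailDominationCert → ∀ κ₀ : ℝ, 0 < κ₀ → ∀ c₀ : ℝ, 0 < c₀ → ∀ C₁ : ℝ, 0 < C₁ →
    ∃ C : ℝ, 1 ≤ C ∧ ∃ ϱ₁ : ℝ, 1 ≤ ϱ₁ ∧ ∀ ϱ : ℝ, ϱ₁ ≤ ϱ → ∀ t : ℝ, 0 < t → t ≤ 1 / 2 → ∃ n₁ : ℝ, 0 < n₁ ∧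
      ∀ (a b : E3) (w : ℤ → E3), IsLayeredCrystal c₀ a b w → IsTameIndexing C₁ a b w → CoerciveZ (layeredKernel a b w) κ₀ →
        DecayAt C ϱ t n₁ a b w

/-- ★★ **(D₂) «ReChartPL aHi Λ θ s s'»** — THE RE-CHART: for every equilibrium `s`-chart `(L, w)` with a `c₀`-co-Lipschitz `C₁`-tame `κ₀`-coercive
indexing `w'` of its layered set CARRYING the decay package `DecayAt C ϱ (min (1/2) (K t)) n₁` (ratio distortion `K`, chosen here after `(c₀, C₁, C)`:
small index ball ⊇ `lsite`-preimage of the physical ball holding `Ψ(win (tρ))` and its `4`-neighbours, big index ball mapped inside the harmonic ball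
`closedBall (Ψ 0) (4ρ)`), every `ϱ`-truncated-harmonic split `IsHarmSplit ϱ κh κd 4 ρ S H Ψ h σ τ` of a θ-good `aHi`-door set re-registers at radius `t ρ`
under an equilibrium `s'`-chart at level `C'·(t² κh + κd/t³)`.  Mechanism (bookkeeping + one re-equilibration): pull `h` back to `φ := h ∘ lsite`
(`IsTruncHarmonic` ⇒ `IsTruncHarmonicZ` on the big index ball; `idxEnergy φ ≲ Σ σ² ≤ κh·#win` by telescoping along clean chains); the package gives
`T = (γ ↦ Σ γⱼ aⱼ + c_k)`; new chart `L' := (I + B) L` (`B` = the in-plane gradient of `T`, `‖B‖ ≲ √κh ≤ √η₁`, absorbed by `s' > s` and the `Λ`-slack of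
conformal charts at the scales where the hypothesis is satisfiable), offsets re-equilibrated (`IsNash`) at cost `≲ t² κh` per site (layer-mean profile
of a harmonic field is affine across layers up to `nn`-differences `t√κh`; interlayer stiffness `κ₀`), `Ψ' :=` the re-charted registration, misfit
`τ' ≲ |δ(φ − T)| + |δ d|` along `≤ 8/c₀`-step index chains (`Σ τ'² ≲ idxEnergy (φ − T) + κd·#win ρ`, normalised by `#win (tρ) ≳ t³ #win ρ`), `EnvClose`
from cleanliness of `S` and of the chart + registration consistency, position clause by translation freedom + discrete Poincaré on `win (tρ)`; for
`K t > 1/2` restriction alone suffices (`C' ≥ 32 K⁵·…`).  UNDECIDED · TRUE-type · ATTACKABLE·M.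
Why it might fail: existence of the re-equilibrated NASH chart near `((I+B)L, c_k)` is an implicit-function step on the inner-displacement (layer-chain)
map, invertible by `κ₀` on layer-constant modes — for an aperiodic stacking word this is an `ℓ^∞`-chain IFT whose uniformity must be checked; and
`‖L'‖ ≤ Λ` uses the slack `a(1+s') < Λ`, automatic at the column instance only where the hypothesis is satisfiable.
Sources: [giaquinta1984 Ch. III (Campanato iteration: replacing the affine map)], [kruzik2019 p.55 Thm 1.1.12], [EMing2006 (inner relaxation of
multilattices, Cauchy–Born)], [this tree: part Q `IsRegistered`, `nearHomH1BDE_mono`, part R `IsHarmSplit`, `isHarmSplit_self`]. [this file, g31] -/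
def ReChartPL (aHi Λ θ s s' : ℝ) : Prop :=
  TailDominationCert → LayeredLiouvilleCert →
    ∀ δ : ℝ, 0 < δ → ∀ a : ℝ, 0 < a → ∀ κ₀ : ℝ, 0 < κ₀ → ∀ c₀ : ℝ, 0 < c₀ → ∀ C₁ : ℝ, 0 < C₁ → ∀ C : ℝ, 1 ≤ C →
      ∃ K : ℝ, 1 ≤ K ∧ ∃ C' : ℝ, 0 < C' ∧ ∀ ϱ : ℝ, 1 ≤ ϱ → ∀ t : ℝ, 0 < t → t ≤ 1 / 2 → ∀ n₁ : ℝ, 0 < n₁ →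
        ∃ η₁ : ℝ, 0 < η₁ ∧ ∃ R₁ : ℝ, 0 < R₁ ∧
          ∀ S : Set E3, IsDoorSetP aHi δ S → (∀ q ∈ S, IsTwoShellAffineGood θ S q) →
            ∀ κh : ℝ, 0 < κh → κh ≤ η₁ → ∀ κd : ℝ, 0 < κd → κd ≤ η₁ → ∀ ρ : ℝ, R₁ ≤ ρ →
              ∀ (L : E3 ≃L[ℝ] E3) (w w' : ℤ → E3), IsEquilChart a s Λ L w →
                Layered ((L : E3 →L[ℝ] E3) (triangularVec₁ 1)) ((L : E3 →L[ℝ] E3) (triangularVec₂ 1)) w' = LayeredHom (L : E3 →L[ℝ] E3) w →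
                IsLayeredCrystal c₀ ((L : E3 →L[ℝ] E3) (triangularVec₁ 1)) ((L : E3 →L[ℝ] E3) (triangularVec₂ 1)) w' →
                IsTameIndexing C₁ ((L : E3 →L[ℝ] E3) (triangularVec₁ 1)) ((L : E3 →L[ℝ] E3) (triangularVec₂ 1)) w' →
                CoerciveZ (layeredKernel ((L : E3 →L[ℝ] E3) (triangularVec₁ 1)) ((L : E3 →L[ℝ] E3) (triangularVec₂ 1)) w') κ₀ →
                DecayAt C ϱ (min (1 / 2) (K * t)) n₁ ((L : E3 →L[ℝ] E3) (triangularVec₁ 1)) ((L : E3 →L[ℝ] E3) (triangularVec₂ 1)) w' →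
                  ∀ (Ψ h : E3 → E3) (σ τ : E3 → ℝ), IsHarmSplit ϱ κh κd 4 ρ S (LayeredHom (L : E3 →L[ℝ] E3) w) Ψ h σ τ →
                    NearHomH1BDE a s' Λ (C' * (t ^ 2 * κh + κd / t ^ 3)) 4 (t * ρ) S (atomsIn (μS S) 0 (t * ρ))

/-- (U♮) ⇒ (U): forget tameness. [this file, g31] -/
theorem uniformEquilStability_of_tame {s Λ : ℝ} (h : UniformTameStability s Λ) : UniformEquilStability s Λ := by
  intro a ha
  obtain ⟨κ₀, hκ₀, c₀, hc₀, C₁, _, hch⟩ := h a ha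
  refine ⟨κ₀, hκ₀, c₀, hc₀, fun L w hE => ?_⟩
  obtain ⟨w', h1, h2, _, h4⟩ := hch L w hE
  exact ⟨w', h1, h2, h4⟩

/-- (U♮) ⇒ (D₀) (trivially). [this file, g31] -/
theorem tameReindex_of_tame {s Λ : ℝ} (h : UniformTameStability s Λ) : TameReindex s Λ :=
  fun _ => h

/-! ## §IV.3  ★★★ The glue: (D) ⟸ (D₀) ∧ (D₁) ∧ (D₂) — PROVED (threading of constants, ranges, ratios and floors) -/

/-- ★★★ **(D)(aHi;Λ,θ,s,s') ⟸ (D₀)(s,Λ) ∧ (D₁) ∧ (D₂)(aHi;Λ,θ,s,s') (PROVED)** — see the header's GLUE CONSTANTS. [this file, g31] -/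
theorem splitDecayPL_of_reindex_decay_rechart {aHi Λ θ s s' : ℝ} (h₀ : TameReindex s Λ) (h₁ : InteriorDecayCert)
    (h₂ : ReChartPL aHi Λ θ s s') : SplitDecayPL aHi Λ θ s s' := by
  intro hT hU hL' δ hδ a ha
  obtain ⟨κ₀, hκ₀, c₀, hc₀, C₁, hC₁, hch⟩ := h₀ hU a ha
  obtain ⟨C, hC, ϱ₁, hϱ₁, hdec⟩ := h₁ hT κ₀ hκ₀ c₀ hc₀ C₁ hC₁
  obtain ⟨K, hK, C', hC', hre⟩ := h₂ hT hL' δ hδ a ha κ₀ hκ₀ c₀ hc₀ C₁ hC₁ C hC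
  refine ⟨C', hC', ϱ₁, hϱ₁, fun ϱ hϱ t ht hth => ?_⟩
  have ht' : 0 < min (1 / 2) (K * t) := lt_min (by norm_num) (mul_pos (zero_lt_one.trans_le hK) ht)
  obtain ⟨n₁, hn₁, hdec'⟩ := hdec ϱ hϱ (min (1 / 2) (K * t)) ht' (min_le_left _ _)
  obtain ⟨η₁, hη₁, R₁, hR₁, hS⟩ := hre ϱ (hϱ₁.trans hϱ) t ht hth n₁ hn₁
  refine ⟨η₁, hη₁, R₁, hR₁, fun S hSd hg κh hκh hκh₁ κd hκd hκd₁ ρ hρ hsplit => ?_⟩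
  obtain ⟨L, w, hE, Ψ, h, σ, τ, hsp⟩ := hsplit
  obtain ⟨w', hset, hX, htame, hco⟩ := hch L w hE
  exact hS S hSd hg κh hκh hκh₁ κd hκd hκd₁ ρ hρ L w w' hE hset hX htame hco (hdec' _ _ _ hX htame hco) Ψ h σ τ hsp

/-- ★★ **(D) ⟸ (U♮) ∧ (D₁) ∧ (D₂)** — the variant with the tame census certificate in place of the transfer (D₀). [this file, g31] -/
theorem splitDecayPL_of_tame_decay_rechart {aHi Λ θ s s' : ℝ} (hU : UniformTameStability s Λ) (h₁ : InteriorDecayCert)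
    (h₂ : ReChartPL aHi Λ θ s s') : SplitDecayPL aHi Λ θ s s' :=
  splitDecayPL_of_reindex_decay_rechart (tameReindex_of_tame hU) h₁ h₂

/-- ★★ **(HD) ⟸ (T) ∧ (U) ∧ (A) ∧ (D₀) ∧ (D₁) ∧ (D₂) (PROVED)** — part R's glue with (D) resolved. [this file, g31] -/
theorem harmonicDecayPGL_of_six_pieces {aHi Λ θ s s' : ℝ} (hT : TailDominationCert) (hU : UniformEquilStability s Λ)
    (hA : HarmonicApproxPGL aHi Λ θ s) (h₀ : TameReindex s Λ) (h₁ : InteriorDecayCert) (h₂ : ReChartPL aHi Λ θ s s') :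
    HarmonicDecayPGL aHi Λ θ s s' :=
  harmonicDecayPGL_of_tail_unif_approx_decay hT hU hA (splitDecayPL_of_reindex_decay_rechart h₀ h₁ h₂)

/-- ★★ **H♭^ℓ ⟸ (P) ∧ (T) ∧ (U) ∧ (A) ∧ (D₀) ∧ (D₁) ∧ (D₂) ∧ (C) (PROVED)**. [this file, g31] -/
theorem halvingBasinPGL_of_seven_pieces {aHi Λ θ s s' : ℝ} (hP : RegistrationP aHi Λ θ s) (hT : TailDominationCert)
    (hU : UniformEquilStability s Λ) (hA : HarmonicApproxPGL aHi Λ θ s) (h₀ : TameReindex s Λ) (h₁ : InteriorDecayCert)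
    (h₂ : ReChartPL aHi Λ θ s s') (hC : CaccioppoliPGL aHi Λ θ s') : HalvingBasinPGL aHi Λ θ s :=
  halvingBasinPGL_of_reg_split_cacc hP hT hU hA (splitDecayPL_of_reindex_decay_rechart h₀ h₁ h₂) hC

/-! ## §IV.4  ★ Columns `_16XH5` (beneath `_16XH4`: the leaf (D) replaced by (D₀), (D₁), (D₂)) -/

/-- ★★★ **COLUMN `_16XH5` — FOURTEEN opaque leaves, THE COLUMN OF THIS NODE**: `LatticeLiouvilleCert → LayeredLiouvilleCert → R_G(1;2,1/16,1/16) →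
X(1;2,1/16,1/16) → Z_E(1;2,1/16,1/50) → P(1;2,1/16,1/50) → T → U(1/50,2) → A(1;2,1/16,1/50) → D₀(1/50,2) → D₁ → D₂(1;2,1/16,1/50,1/25) →
C(1;2,1/16,1/25) → PeriodicBulkGapDoor 2 → VisibleGap (1/50) ∧ PertRegime (1/50)`. [this file, g31] -/
theorem gap_and_pert_1_50_of_certs_16XH5 (hL : LatticeLiouvilleCert) (hL' : LayeredLiouvilleCert)
    (hR : OscRigidityL2BDPG 1 2 (1 / 16) (1 / 16)) (hX : ExcessFlatnessControlP 1 2 (1 / 16) (1 / 16))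
    (hE : ExcessChartLocalisationP 1 2 (1 / 16) (1 / 50)) (hP : RegistrationP 1 2 (1 / 16) (1 / 50))
    (hT : TailDominationCert) (hU : UniformEquilStability (1 / 50) 2) (hA : HarmonicApproxPGL 1 2 (1 / 16) (1 / 50))
    (h₀ : TameReindex (1 / 50) 2) (h₁ : InteriorDecayCert) (h₂ : ReChartPL 1 2 (1 / 16) (1 / 50) (1 / 25))
    (hCc : CaccioppoliPGL 1 2 (1 / 16) (1 / 25)) (hG : PeriodicBulkGapDoor 2) : VisibleGap (1 / 50) ∧ PertRegime (1 / 50) :=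
  gap_and_pert_1_50_of_certs_16XH4 hL hL' hR hX hE hP hT hU hA (splitDecayPL_of_reindex_decay_rechart h₀ h₁ h₂) hCc hG

/-- ★★ **COLUMN `_16XH5`, resolved form — EIGHTEEN leaves (the audit column)**: `LJDecay → LJMoments → CleanCrystalStability → LayeredDecay →
LayeredMoments → LayeredCrystalStability → R_G → X → Z_E → P → T → U → A → D₀ → D₁ → D₂ → C → HBG″ → VisibleGap (1/50) ∧ PertRegime (1/50)`. [this file, g31] -/
theorem gap_and_pert_1_50_of_layered_pieces_16XH5 (hD : LJDecay) (hM : LJMoments) (hC : CleanCrystalStability)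
    (hD' : LayeredDecay) (hM' : LayeredMoments) (hC' : LayeredCrystalStability)
    (hR : OscRigidityL2BDPG 1 2 (1 / 16) (1 / 16)) (hX : ExcessFlatnessControlP 1 2 (1 / 16) (1 / 16))
    (hE : ExcessChartLocalisationP 1 2 (1 / 16) (1 / 50)) (hP : RegistrationP 1 2 (1 / 16) (1 / 50))
    (hT : TailDominationCert) (hU : UniformEquilStability (1 / 50) 2) (hA : HarmonicApproxPGL 1 2 (1 / 16) (1 / 50))
    (h₀ : TameReindex (1 / 50) 2) (h₁ : InteriorDecayCert) (h₂ : ReChartPL 1 2 (1 / 16) (1 / 50) (1 / 25))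
    (hCc : CaccioppoliPGL 1 2 (1 / 16) (1 / 25)) (hG : PeriodicBulkGapDoor 2) : VisibleGap (1 / 50) ∧ PertRegime (1 / 50) :=
  gap_and_pert_1_50_of_layered_pieces_16XH4 hD hM hC hD' hM' hC' hR hX hE hP hT hU hA
    (splitDecayPL_of_reindex_decay_rechart h₀ h₁ h₂) hCc hG

/-- ★★ **COLUMN `_16XH5♮` — the census-leaf variant: (U♮) as the single stability leaf (it yields (U) for (A) and (D₀) for (D)); THIRTEEN opaque leaves.** [this file, g31] -/
theorem gap_and_pert_1_50_of_certs_16XH5_tame (hL : LatticeLiouvilleCert) (hL' : LayeredLiouvilleCert)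
    (hR : OscRigidityL2BDPG 1 2 (1 / 16) (1 / 16)) (hX : ExcessFlatnessControlP 1 2 (1 / 16) (1 / 16))
    (hE : ExcessChartLocalisationP 1 2 (1 / 16) (1 / 50)) (hP : RegistrationP 1 2 (1 / 16) (1 / 50))
    (hT : TailDominationCert) (hU : UniformTameStability (1 / 50) 2) (hA : HarmonicApproxPGL 1 2 (1 / 16) (1 / 50))
    (h₁ : InteriorDecayCert) (h₂ : ReChartPL 1 2 (1 / 16) (1 / 50) (1 / 25))
    (hCc : CaccioppoliPGL 1 2 (1 / 16) (1 / 25)) (hG : PeriodicBulkGapDoor 2) : VisibleGap (1 / 50) ∧ PertRegime (1 / 50) :=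
  gap_and_pert_1_50_of_certs_16XH5 hL hL' hR hX hE hP hT (uniformEquilStability_of_tame hU) hA (tameReindex_of_tame hU) h₁ h₂ hCc hG

end Summit.AtomisticToContinuum.Crystallization.Theorems.ChartedZeroExcessLayeredLatticeLiouville

end
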